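import Literature.Probability.Percolation.SepArmsQuasiMult
import HarnessLib

/-!
# Extendability of the `k`-arm probabilities (`k ≤ 6`, any colours) from arm separation

Topic: Probability / Percolation; family `crit-perc` (critical site percolation `P = P_{1/2}` on the
triangular lattice `𝕋`; the order-free arm probabilities `polyArmProb κ n N` of `ArmEvents.lean`).
Companion of `SepArmsQuasiMult.lean` toward the named fact
`Literature.Probability.Percolation.Nolin2008_prop17_quasiMult` (P. Nolin, *Near-critical percolation
in two dimensions*, EJP 13 (2008), §4.5): the other item of Nolin's Prop. 12 [arXiv 0711.4948:
Prop. 11] — (i) "once well-separated, the arms can easily be extended" — for the generic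
well-separated event `sepArms κ` of `SepArmsGlue.lean`, and the resulting extendability of
`π_κ = polyArmProb κ` (Prop. 16 [arXiv Prop. 15]) FROM the separation hypothesis
`c · π_κ(n, N) ≤ P_{1/2}(sepArms κ n N)` (Thm. 11 [arXiv Thm. 10] for the pattern `(k, κ)`):

* `pow_le_real_sepArmsGlueExtCol` — RSW/Harris for the extension events of one colour;
* `sepArms_mul_glueExt_le` — **the extension inequality**
  `P(sepArms κ n₁ (64q)) · P(ext, open) · P(ext, closed) ≤ π_κ(n₁, 512(q+1) - 1)` (Lemma 13 [arXiv
  Lemma 12] with the shared region `Λ_{64q}`, `sepArms_glueExt_subset`);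
* `polyArmProb_extend_of_sepArms` — `c_E · π_κ(n, 64q) ≤ π_κ(n, 512(q+1) - 1)` from separation.

Everything here is PROVED; no definition and no named fact is introduced.

## References

* P. Nolin, *Near-critical percolation in two dimensions*, Electron. J. Probab. 13 (2008),
  1562–1623, §4.3 Prop. 12 (i), Lemma 13, §4.5 Prop. 16 [arXiv 0711.4948: Prop. 11, Lemma 12,
  Prop. 15]. [Nolin2008]
* H. Kesten, *Scaling relations for 2D-percolation*, Comm. Math. Phys. 109 (1987). [Kesten1987]

Tree: `sepArms`, `sepArmsCol`, `sepArmsGlueExtCol`, `mem_sepArmsGlueExtCol`, `sepArms_eq_inter`,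
`sepArmsCol_inter_subset`, `determinedBy_sepArmsCol`, `sepArms_glueExt_subset` (`SepArmsGlue.lean`);
`pow_le_real_biInter_readFrame_true` (`SepArmsQuasiMult.lean`); `fourGlueExt`, `determinedBy_fourGlueExt`,
`isUpperSet_fourGlueExt`, `fourGlueExtFinset_subset` (`ArmSeparationFourArm.lean`); `exists_le_real_fourGlue`
(`ArmSeparationFourArmProofs.lean`); `triSitePercolation_locallyMonotone_fkg` (`LocallyMonotoneFKG.lean`).
-/

noncomputable section

open MeasureTheory Set

namespace Literature.Probability.Percolation

open LatticeModels

variable {k : ℕ}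

/-! ### RSW for the extension events of one colour -/

/-- The extension events of the arms of colour `b` as rotated copies in colour `true` of the
configuration read in colour `b`. [folklore] -/
theorem sepArmsGlueExtCol_eq_preimage (κ : Fin k → Bool) (b : Bool) (q : ℕ) :
    sepArmsGlueExtCol κ b q = (fun ω : SiteConfig (Site 2) => {v : Site 2 | v ∈ ω ↔ b}) ⁻¹'
      (⋂ j ∈ Finset.univ.filter (fun j : Fin k => κ j = b), readFrame (j : Fin k).val true ⁻¹' fourGlueExt q) := by
  ext ω
  simp only [mem_sepArmsGlueExtCol, mem_preimage, mem_iInter, Finset.mem_filter, Finset.mem_univ, true_and,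
    readFrame, iff_true, setOf_mem_eq]

/-- **RSW for the extension events of one colour**: `c ^ k ≤ P_{1/2}(sepArmsGlueExtCol κ b q)`
whenever `c ≤ P_{1/2}(fourGlueExt q)`, `0 ≤ c ≤ 1`. [cite: Nolin2008, §4.3 Prop. 12 (proof) (arXiv 0711.4948: Prop. 11)] -/
theorem pow_le_real_sepArmsGlueExtCol (κ : Fin k → Bool) (b : Bool) {q : ℕ} {c : ℝ} (hc0 : 0 ≤ c) (hc1 : c ≤ 1)
    (hcG : c ≤ (triSitePercolation half).real (fourGlueExt q)) :
    c ^ k ≤ (triSitePercolation half).real (sepArmsGlueExtCol κ b q) := by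
  rw [sepArmsGlueExtCol_eq_preimage, triSitePercolation_half_real_preimage_colour]
  exact pow_le_real_biInter_readFrame_true _ (determinedBy_fourGlueExt q) (isUpperSet_fourGlueExt q) hc0 hc1 hcG

/-! ### The extension inequality (Nolin 2008, Prop. 12 (i), Lemma 13) -/

set_option maxHeartbeats 1600000 in
set_option maxRecDepth 4096 in
/-- **The extension inequality for `k ≤ 6` well-separated arms of any colours** (Nolin 2008,
Prop. 12 (i) [arXiv 0711.4948: Prop. 11], extendability, `p = 1/2`):
`P(sepArms κ n₁ (64q)) · P(ext, open) · P(ext, closed) ≤ π_κ(n₁, 512(q+1) - 1)`, by Nolin's Lemma 13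
(`triSitePercolation_locallyMonotone_fkg`) with the shared region `Λ_{64q}`, increasing region the
open cones and decreasing region the closed cones of `{64q < |·|_𝕋 < 512(q+1)}`, and the
deterministic extension `sepArms_glueExt_subset`. [cite: Nolin2008, §4.3 Prop. 12 (i) and Lemma 13 (arXiv 0711.4948: Prop. 11, Lemma 12)] -/
theorem sepArms_mul_glueExt_le (hk : k ≤ 6) (κ : Fin k → Bool) {q n₁ : ℕ} (hq : 1 ≤ q) (h4 : 4 ≤ n₁)
    (h₁ : n₁ ≤ 64 * q) :
    (triSitePercolation half).real (sepArms κ n₁ (64 * q)) *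
        ((triSitePercolation half).real (sepArmsGlueExtCol κ true q) *
          (triSitePercolation half).real (sepArmsGlueExtCol κ false q)) ≤ polyArmProb κ n₁ (512 * (q + 1) - 1) := by
  classical
  set S : Finset (Site 2) := triBall (64 * q) with hS
  set R : Bool → Finset (Site 2) := fun b => (triBall (512 * (q + 1))).filter
    (fun v => (64 * q : ℤ) < triNorm v ∧ triNorm v < 512 * ((q : ℤ) + 1) ∧
      ∃ j : Fin k, κ j = b ∧ (0 < (triRotIsoPow j.val).symm v 0 ∧ (triRotIsoPow j.val).symm v 1 < 0 ∧
        0 < (triRotIsoPow j.val).symm v 0 + (triRotIsoPow j.val).symm v 1)) with hR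
  have hSR : ∀ b, Disjoint S (R b) := fun b => by
    rw [Finset.disjoint_left]; intro v hvS hvR
    simp only [hS, hR, Finset.mem_filter, mem_triBall_iff] at hvS hvR
    obtain ⟨-, h1, -, -⟩ := hvR
    push_cast at hvS h1; omega
  have hRR : Disjoint (R true) (R false) := by
    rw [Finset.disjoint_left]; intro v hvP hvM
    simp only [hR, Finset.mem_filter] at hvP hvM
    obtain ⟨-, -, -, i, hi, hci⟩ := hvP
    obtain ⟨-, -, -, j, hj, hcj⟩ := hvM
    have hij : i.val = j.val := rot_sector_injective (lt_of_lt_of_le i.2 hk) (lt_of_lt_of_le j.2 hk) hci hcj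
      (by rw [RelIso.apply_symm_apply, RelIso.apply_symm_apply])
    have : κ i = κ j := by rw [Fin.ext hij]
    rw [hi, hj] at this
    exact Bool.noConfusion this
  have e8 : 64 * q / 8 = 8 * q := by omega
  -- a rotated cone site of the middle annulus lies in the region of its colour
  have memR : ∀ (b : Bool) (j : Fin k), κ j = b → ∀ v : Site 2, (64 * q : ℤ) < triNorm v → triNorm v < 512 * ((q : ℤ) + 1) →
      (0 < v 0 ∧ v 1 < 0 ∧ 0 < v 0 + v 1) → triRotIsoPow j.val v ∈ (↑(R b) : Set (Site 2)) := by
    intro b j hj v h1 h2 hc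
    simp only [hR, Finset.coe_filter, mem_setOf_eq, mem_triBall_iff, triNorm_rot]
    refine ⟨by omega, h1, h2, j, hj, ?_⟩
    rw [RelIso.symm_apply_apply]
    exact hc
  -- supports of the arm events
  have hIn : ∀ (b : Bool) (j : Fin k), κ j = b →
      triRotIsoPow j.val '' sepConeSupport n₁ (64 * q) ⊆ ↑S ∪ ↑(R b) := by
    rintro b j hj w ⟨v, hv, rfl⟩
    rw [mem_sepConeSupport, e8] at hv
    push_cast at hv
    by_cases h64 : triNorm v ≤ 64 * (q : ℤ)
    · left
      simp only [Finset.mem_coe, hS, mem_triBall_iff, triNorm_rot]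
      exact h64
    · right
      exact memR b j hj v (by omega) (by omega) (hv.2.2 (Or.inr (by omega)))
  -- supports of the extension events
  have hGl : ∀ (b : Bool) (j : Fin k), κ j = b →
      triRotIsoPow j.val '' (↑(fourGlueExtFinset q) : Set (Site 2)) ⊆ ↑(R b) := by
    rintro b j hj w ⟨v, hv, rfl⟩
    have h := fourGlueExtFinset_subset hq (Finset.mem_coe.1 hv)
    have hn : triNorm v = v 0 := triNorm_eq_apply_zero h.2.2.1.le h.2.2.2.le
    exact memR b j hj v (by rw [hn]; exact h.1) (by rw [hn]; exact h.2.1) ⟨by omega, h.2.2.1, h.2.2.2⟩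
  -- locality of the events
  have dA : ∀ b : Bool, DeterminedBy (sepArmsCol κ b n₁ (64 * q)) (↑S ∪ ↑(R b)) := fun b =>
    determinedBy_sepArmsCol κ b h4 h₁ (hIn b)
  have dG := determinedBy_fourGlueExt q
  have dB : ∀ b : Bool, DeterminedBy (sepArmsGlueExtCol κ b q) ↑(R b) := fun b =>
    DeterminedBy.iInter fun j => DeterminedBy.iInter fun hj =>
      (determinedBy_preimage_readFrame j.val b dG).mono (hGl b j hj)
  have uB : IsUpperSet (sepArmsGlueExtCol κ true q) :=
    isUpperSet_iInter fun j => isUpperSet_iInter fun _ => IsUpperSet.preimage_readFrame_true j.val (isUpperSet_fourGlueExt q)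
  have lB : IsLowerSet (sepArmsGlueExtCol κ false q) :=
    isLowerSet_iInter fun j => isLowerSet_iInter fun _ => IsUpperSet.preimage_readFrame_false j.val (isUpperSet_fourGlueExt q)
  -- Nolin's Lemma 13
  have fkg := triSitePercolation_locallyMonotone_fkg half (hSR true) (hSR false) hRR
    (Ap := sepArmsCol κ true n₁ (64 * q)) (Am := sepArmsCol κ false n₁ (64 * q))
    (Bp := sepArmsGlueExtCol κ true q) (Bm := sepArmsGlueExtCol κ false q)
    (isUpperSet_sepArmsCol_true κ n₁ (64 * q)) (isLowerSet_sepArmsCol_false κ n₁ (64 * q)) uB lB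
    (dA true) (dA false) (dB true) (dB false)
  -- the deterministic extension
  have hsub : sepArmsCol κ true n₁ (64 * q) ∩ sepArmsCol κ false n₁ (64 * q) ∩
      (sepArmsGlueExtCol κ true q ∩ sepArmsGlueExtCol κ false q) ⊆ armEvent κ n₁ (512 * (q + 1) - 1) := by
    rintro ω ⟨hAC, hB⟩
    exact sepArms_glueExt_subset hk κ hq h4 h₁ ⟨sepArmsCol_inter_subset κ _ _ hAC, hB⟩
  calc (triSitePercolation half).real (sepArms κ n₁ (64 * q)) *
        ((triSitePercolation half).real (sepArmsGlueExtCol κ true q) *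
          (triSitePercolation half).real (sepArmsGlueExtCol κ false q))
      = (triSitePercolation half).real (sepArmsCol κ true n₁ (64 * q) ∩ sepArmsCol κ false n₁ (64 * q)) *
          ((triSitePercolation half).real (sepArmsGlueExtCol κ true q) *
            (triSitePercolation half).real (sepArmsGlueExtCol κ false q)) := by rw [← sepArms_eq_inter]
    _ ≤ _ := fkg
    _ ≤ polyArmProb κ n₁ (512 * (q + 1) - 1) := measureReal_mono hsub (measure_ne_top _ _)

/-- **Extendability from separation** (Nolin 2008, Prop. 12 (i) with Thm. 11, and Prop. 16
[arXiv 0711.4948: Prop. 11, Thm. 10, Prop. 15], `k ≤ 6` arms of colours `κ`, `p = 1/2`): IF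
`c · π_κ(n, N) ≤ P_{1/2}(sepArms κ n N)` for `n₀ ≤ n`, `2n ≤ N`, THEN
`c_E · π_κ(n, 64q) ≤ π_κ(n, 512(q+1) - 1)` for `q ≥ 1`, `n₀ ∨ 4 ≤ n`, `2n ≤ 64q`: arms reaching
`∂Λ_{64q}` reach `∂Λ_{512(q+1)-1}`, eight times further, at constant cost. [cite: Nolin2008, §4.3 Prop. 12 (i) and §4.5 Prop. 16 (arXiv 0711.4948: Prop. 11, Prop. 15)] -/
theorem polyArmProb_extend_of_sepArms (hk : k ≤ 6) (κ : Fin k → Bool)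
    (hsep : ∃ c : ℝ, 0 < c ∧ ∃ n₀ : ℕ, ∀ n N : ℕ, n₀ ≤ n → 2 * n ≤ N →
      c * polyArmProb κ n N ≤ (triSitePercolation half).real (sepArms κ n N)) :
    ∃ cE : ℝ, 0 < cE ∧ ∃ n₀ : ℕ, ∀ q n : ℕ, 1 ≤ q → n₀ ≤ n → 2 * n ≤ 64 * q →
      cE * polyArmProb κ n (64 * q) ≤ polyArmProb κ n (512 * (q + 1) - 1) := by
  obtain ⟨c, hc, n₀, hs⟩ := hsep
  obtain ⟨cg, hcg, hg⟩ := exists_le_real_fourGlue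
  have hcg1 : cg ≤ 1 := ((hg 1 le_rfl).2).trans measureReal_le_one
  refine ⟨c * (cg ^ k * cg ^ k), by positivity, max n₀ 4, fun q n hq hn h2 => ?_⟩
  have hn₀ : n₀ ≤ n := le_trans (le_max_left _ _) hn
  have h4 : 4 ≤ n := le_trans (le_max_right _ _) hn
  have h₁ : n ≤ 64 * q := by omega
  have hsepn := hs n (64 * q) hn₀ h2
  have hGT := pow_le_real_sepArmsGlueExtCol κ true hcg.le hcg1 (hg q hq).2
  have hGF := pow_le_real_sepArmsGlueExtCol κ false hcg.le hcg1 (hg q hq).2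
  have key := sepArms_mul_glueExt_le hk κ hq h4 h₁
  calc c * (cg ^ k * cg ^ k) * polyArmProb κ n (64 * q)
      = (c * polyArmProb κ n (64 * q)) * (cg ^ k * cg ^ k) := by ring
    _ ≤ (triSitePercolation half).real (sepArms κ n (64 * q)) *
          ((triSitePercolation half).real (sepArmsGlueExtCol κ true q) *
            (triSitePercolation half).real (sepArmsGlueExtCol κ false q)) :=
        mul_le_mul hsepn (mul_le_mul hGT hGF (by positivity) measureReal_nonneg) (by positivity) measureReal_nonneg
    _ ≤ polyArmProb κ n (512 * (q + 1) - 1) := key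

end Literature.Probability.Percolation

end
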